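import Summits.SmoothPoincare4.SmoothPoincare4.Theses.InformationMetricHadamard
import Summits.SmoothPoincare4.SmoothPoincare4.Theorems.PICReduction
import Summits.SmoothPoincare4.SmoothPoincare4.Theorems.InformationMetricHadamardAhHadamardFillingStubLocallyConvexEndForcesHadamard
import Summits.SmoothPoincare4.SmoothPoincare4.Theorems.AhHadamardFilling.Negative.SketchLineCircular
import Literature.Geometry.GaugeTheory.InstantonEntropy
import HarnessLib

/-!
# Line `osculating-poisson-collar` — skeleton for crux `InformationMetricHadamard.AhHadamardFilling`
# (item stmt-SmoothPoincare4-6014, route `InformationMetricHadamard`, rank 2)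

CRUX-PLAN SKELETON (planner `planner-cruxplan-stmt-SmoothPoincare4-6014-osculating-poisson-c-0`,
2026-08-16; idea card `Cruxes/AhHadamardFilling/Ideas/osculating-poisson-collar.md`, triage r1-1
pass / r1-2 pass; line card `Lines/osculating-poisson-collar.md`).

Crux (fixed, never restated): every homotopy 4-sphere `Σ` carries a Riemannian metric `g` and is
the cross-section of a proper end collar `Φ : Σ × (0,1) → W` of a Cartan–Hadamard 5-manifold
`(W, G)` (complete, simply connected, `sec ≤ 0`) on which `G` is `C⁰`-asymptotic to
`c (dλ² + g)/λ²`.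

## What this line does that `Sketch` (dead, L5(iii)) could not

`Sketch`'s only open stub was an `∃ W`-statement (`TameFillingNoPi1`), kernel-certified `↔
SmoothPoincare4` (`Negative/SketchLineCircular.lean`, p121624): the witness was free, so the stub
said nothing more than the summit. Here the witness is PINNED to the canonical object of the route,
the charge-one instanton moduli space with Hitchin's information metric, through the tree's honest
carrier `Literature.Geometry.GaugeTheory.AsdModuliSpace g o 1` (quotient of the `g`-ASD
connections on `P₁ → Σ` by gauge, `C^∞` topology) and its `density` `[A] ↦ |F_A|²_g`:

* `InfoBulk S g hg` (vocabulary, an INTERFACE — no existence inside): a smooth 5-manifold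
  structure `W` on the non-compact (collar) component of `M₁(Σ, g)` (`ι : W → M₁` an open
  embedding with closed range, `W` connected and non-compact) in which the curvature-density
  family `(w, x) ↦ ρ_{ι w}(x)` is jointly smooth;
* `fisherForm B w v = ∫_Σ (dρ_w(v))² / ρ_w dvol_g` — the Fisher–Rao quadratic form of that family
  (Hitchin 1990; Groisser–Murray 1997 §2, `g_I(a,a) = 4∫(F̂, d_A a)²`), mass normalisation `8π²`
  so that the collar constant is Groisser–Murray's `c = 128π²/5`;
* `IsFisher B G` — `G` IS the information metric: `G_w(v,v) = fisherForm B w v` for all `w, v`.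

Every stub below is a statement about THIS object; none is an `∃ W`-statement, none restates the
crux, the summit or a refuted statement (negatives index: 0 entries for SmoothPoincare4,
2026-08-16).

## The line (card lever: differentiate Groisser–Murray's `C⁰` theorem along Groisser's `O(λ^k)`
## scheme, organised by the osculating `ℍ⁵` Poisson family)

Registered stubs (5; `K_t := (Φ '' (univ ×ˢ Ioo 0 t))ᶜ`):

* `stub_infoBulk` (FACT-level; Atiyah–Hitchin–Singer 1978 Thm 6.1, Freed–Uhlenbeck 1984 Ch. 3,
  Donaldson–Kronheimer 1990 §§4.2–4.3, Taubes 1982, Donaldson 1983 §III, Uhlenbeck 1982): for a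
  Freed–Uhlenbeck-generic metric `g` on a homotopy 4-sphere, `M₁(Σ,g)` (no reducibles: `H²(Σ) = 0`)
  is a smooth 5-manifold with smooth universal density family, and it has a non-compact component
  with closed-open image — `Nonempty (InfoBulk S g hg)`. Zero mathematical risk, XL formally.
* `stub_complete` (L; Groisser–Murray 1997 Thm 3.1 "complete in the collar" + Uhlenbeck/Donaldson:
  the complement of the collar in the component is compact): the information metric on the collar
  component has compact closed balls.
* `stub_scaleConvexCollar` (XL; THE CARD'S LEVER, load-bearing): the Donaldson–Groisser–Parker
  collar `Φ` of the information bulk, with its scale function `lam` (`lam ∘ Φ = pr₂`), is a proper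
  smooth injective immersive end collar, `C⁰`-conical with `c = 128π²/5` (Groisser–Murray 1997
  Thm 3.1 — fact-level part) AND — the new theorem, card K1 — `C¹`-conical with rate `O(λ)`,
  stated in its sharpest usable form: the far slices `{lam = l}` are strictly convex towards the
  core, `Hess_{g_I} lam < 0` on their tangent spaces (model value `−l⁻¹ g`; confirmed at `C²`
  level on `M₁(ℂP²)` by triage r1-1, `CP2CollarCheck.md`: `|Rm − Rm₀| = O(λ²)`).
* `stub_convexCoresOfConvexSlices` (L; pure Riemannian geometry, LANDABLE NOW with tree tools —
  `ConvexSublevelShortGeodesics`, `SegmentsAreGeodesics`, `ExpMapHopfRinow`, collar package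
  p106081): strictly convex far slices of a proper collar in a complete manifold give far cores
  `K_t` with nonempty interior that are `δ`-locally `d`-convex (betweenness form) — exactly the
  `hconv` hypothesis of the landed K1.
* `stub_coreSign` (APEX, open-problem / SPC4-strength by the tame-witness dichotomy
  `Ideas/cruxideate-r1-1-evidence.md` C2 — inherent to the crux, p119273 + `closes`): every
  homotopy 4-sphere carries a Freed–Uhlenbeck-generic metric `g` such that on the collar component
  of `M₁(Σ,g)` the Fisher–Rao form is a smooth Riemannian metric with `sec ≤ 0` (the typed core of
  the route's informal item 7336, minus completeness and topology, which are now other stubs /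
  K1). Its FAR half (`sec → −5/(128π²)` uniformly as `λ → 0`, card K2) is typed below as
  `CollarCurvatureLimit` for the lead to register as `helper_collarCurvatureLimit`; its CORE half
  is CORE SIGN (instrument: the Gauss-equation formula (★) of cards fisher-sphere-gauss ≈
  hellinger-gauss-normal-part); nondegeneracy: Groisser–Murray prove it on the collar and leave
  the interior open (p. 5).

Composition (kernel-checked, no `sorry` of its own): `AhHadamardFilling_of` — `stub_coreSign`
chooses `g` and gives `G = g_I` with `sec ≤ 0`; `stub_infoBulk` realises the collar component;
`stub_complete` gives completeness; `stub_scaleConvexCollar` gives the collar, its scale function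
and the strict convexity of far slices; `stub_convexCoresOfConvexSlices` turns that into locally
convex far cores; the LANDED K1 `Sketch.stub_locallyConvexEndForcesHadamard` (p113043) turns
`ConnectedSpace W` + local convexity into `SimplyConnectedSpace W`; the crux follows BY NAME with
`c = 128π²/5`. Bonus `smoothPoincare4_of_stubs`: K1's second conclusion `Σ ≅ S⁴` makes the five
stubs close the route's `closes` WITHOUT crux 6015 (hardness record: the stubs are summit-strength
together, as every line of this crux must be; the strength sits in `stub_coreSign` alone).

## Disproof.lean honoured

No `Disproof.lean` exists for this crux (payload.disproof_path absent; `ledger crux ls`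
2026-08-16T19:40Z: Ideas/, Lines/Sketch*, PICKED, TRIAGE r1-1/2, CP2CollarCheck only). Landed
Negative lemmas imported and checked against: `Negative/SketchLineCircular.lean`
(`tameFillingNoPi1_iff_smoothPoincare4`) — no stub here is `TameFillingNoPi1` or any `∃ W` filling
statement; `Negative/OfSmoothPoincare4.lean`, `Negative/TameFillingOfSmoothPoincare4.lean` (SPC4 ⇒
crux / X: hardness, not refutations). `ledger negatives --problem SmoothPoincare4`: 0.
-/

noncomputable section

-- the prescribed namespace `Summit.<P>.<Sub>.…` duplicates `SmoothPoincare4` (P = Sub)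
set_option linter.dupNamespace false
set_option linter.unusedVariables false

open scoped Manifold ContDiff Topology ENNReal NNReal
open Set Function MeasureTheory

namespace Summit.SmoothPoincare4.SmoothPoincare4.Cruxes.AhHadamardFilling.OsculatingPoissonCollar

open Literature.Topology.FourManifolds (HomotopySphere SmoothOrientation)
open Literature.Geometry.Lorentzian (PseudoRiemannianMetric)
open Literature.Geometry.GaugeTheory (AsdModuliSpace IsFreedUhlenbeckGeneric volMeasure)

/-! ## Vocabulary of the line (sorry-free definitions over tree declarations only)

A lead who wants stubs closed by SEPARATE `--supports` proposals lands this block verbatim first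
(a `…Defs.lean` Theorems file in this namespace), so that the registered stub signatures resolve
tree-side. -/

/-- A homotopy 4-sphere is nonempty (its homotopy equivalence with `S⁴` has an inverse map; cf.
`HomotopySphere.nonempty_carrier` in `BCSConstruction.lean`). Needed for the base point of `P₁`.
[folklore] -/
instance instNonemptyCarrier (S : HomotopySphere 4) : Nonempty S.carrier :=
  ⟨(Classical.choice S.nonempty_homotopyEquiv).invFun
    ⟨EuclideanSpace.single (0 : Fin 5) (1 : ℝ), by simp [PiLp.norm_single]⟩⟩

/-- Boundary metrics: `C^∞` pseudo-Riemannian metrics on the tangent bundle of `Σ` (the crux's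
type for `g`). [folklore] -/
abbrev BMetric (S : HomotopySphere 4) : Type _ :=
  PseudoRiemannianMetric (𝓡 4) ∞ (EuclideanSpace ℝ (Fin 4)) (TangentSpace (𝓡 4) : S.carrier → Type _)

/-- Bulk metrics: `C^∞` pseudo-Riemannian metrics on a 5-manifold `W` (the crux's type for `G`).
[folklore] -/
abbrev WMetric (W : Type) [TopologicalSpace W] [ChartedSpace (EuclideanSpace ℝ (Fin 5)) W]
    [IsManifold (𝓡 5) ∞ W] : Type _ :=
  PseudoRiemannianMetric (𝓡 5) ∞ (EuclideanSpace ℝ (Fin 5)) (TangentSpace (𝓡 5) : W → Type _)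

/-- **The charge-one information bulk of `(Σ, g)` — interface, no existence asserted.** A smooth
5-manifold `W` realising the non-compact (collar) component of the moduli space
`M₁(Σ, g) = AsdModuliSpace g Σ.orientation 1` of `g`-anti-self-dual `SU(2)`-connections of charge
one: `ι : W → M₁` is an open topological embedding with closed (hence closed-open) range, `W` is
connected and non-compact, and the curvature-density family `(w, x) ↦ ρ_{ι w}(x) = |F_{ι w}|²_g(x)`
is jointly `C^∞`. For a homotopy 4-sphere `H²(Σ) = 0`, so `P₁` carries no reducible ASD
connection and `M₁ = M₁*`; for Freed–Uhlenbeck-generic `g` it is a smooth 5-manifold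
(Atiyah–Hitchin–Singer 1978 Thm 6.1, Freed–Uhlenbeck 1984 Ch. 3, Donaldson–Kronheimer 1990
§§4.2–4.3) whose unique non-compact component carries the Donaldson–Taubes collar `Σ × (0, λ₀)`
(Taubes 1982, Donaldson 1983 §III, Uhlenbeck 1982) — that existence is `stub_infoBulk`, not this
definition. [cite: DonaldsonKronheimer1990, §§4.2–4.3] -/
structure InfoBulk (S : HomotopySphere 4) (g : BMetric S) (hg : g.IsRiemannian) where
  /-- The carrier of the collar component. -/
  W : Type
  [topologicalSpace : TopologicalSpace W]
  [t2Space : T2Space W]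
  [secondCountableTopology : SecondCountableTopology W]
  [chartedSpace : ChartedSpace (EuclideanSpace ℝ (Fin 5)) W]
  [isManifold : IsManifold (𝓡 5) ∞ W]
  [connectedSpace : ConnectedSpace W]
  [noncompactSpace : NoncompactSpace W]
  /-- The identification with a closed-open subset of the moduli space `M₁(Σ, g)`. -/
  ι : W → AsdModuliSpace g S.orientation 1
  isOpenEmbedding : Topology.IsOpenEmbedding ι
  isClosed_range : IsClosed (Set.range ι)
  /-- The universal curvature-density family is smooth on `W × Σ`. -/
  contMDiff_density :
    ContMDiff ((𝓡 5).prod (𝓡 4)) 𝓘(ℝ, ℝ) ∞ (fun p : W × S.carrier ↦ (ι p.1).density g p.2)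

attribute [instance] InfoBulk.topologicalSpace InfoBulk.t2Space InfoBulk.secondCountableTopology
  InfoBulk.chartedSpace InfoBulk.isManifold InfoBulk.connectedSpace InfoBulk.noncompactSpace

/-- The derivative of the density at the boundary point `x` along the moduli direction `v` at
`w`: `dρ_w(v)(x)` (Mathlib's `mfderiv` of `w' ↦ ρ_{ι w'}(x)`, target read in `𝓘(ℝ, ℝ)`; for
`v ↔ a ∈ H¹_A` it is `2(F_A, d_A a)(x)`, Groisser–Murray 1997 §2). [cite: GroisserMurray1997, §2] -/
def densityDeriv {S : HomotopySphere 4} {g : BMetric S} {hg : g.IsRiemannian} (B : InfoBulk S g hg)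
    (x : S.carrier) (w : B.W) (v : TangentSpace (𝓡 5) w) : ℝ :=
  mfderiv (𝓡 5) 𝓘(ℝ, ℝ) (fun w' : B.W ↦ (B.ι w').density g x) w v

/-- **The Fisher–Rao quadratic form of the curvature-density family** at `w ∈ W` on a tangent
vector `v`: `g_I(v, v) = ∫_Σ (dρ_w(v))² / ρ_w dvol_g` (Hitchin 1990; Groisser–Murray 1997 §2,
eq. (metric1): `= 4∫(F̂_A, d_A a)²`, finite, the integrand being dominated by `4|d_A a|²`; at zeros
of `ρ_w` the integrand is `0` since `dρ_w(v) = 2(F, d_A a)` vanishes there — Lean's `0/0 = 0`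
agrees). Unnormalised density of mass `8π²`, so that the collar constant below is
Groisser–Murray's `128π²/5` (Blau–Narain–Thompson 2001 (2.14)–(2.16): `16/5` per unit mass).
[cite: GroisserMurray1997, §2] -/
def fisherForm {S : HomotopySphere 4} {g : BMetric S} {hg : g.IsRiemannian} (B : InfoBulk S g hg)
    (w : B.W) (v : TangentSpace (𝓡 5) w) : ℝ :=
  ∫ x, densityDeriv B x w v ^ 2 / (B.ι w).density g x ∂(volMeasure g hg)

/-- **`G` is the information metric of the bulk `B`**: its quadratic form is the Fisher–Rao form
of the curvature densities at every point (a symmetric bilinear form is determined by its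
quadratic form, so this pins `G = g_I`). [cite: GroisserMurray1997, §2] -/
def IsFisher {S : HomotopySphere 4} {g : BMetric S} {hg : g.IsRiemannian} (B : InfoBulk S g hg)
    (G : WMetric B.W) : Prop :=
  ∀ (w : B.W) (v : TangentSpace (𝓡 5) w), G.val w v v = fisherForm B w v

/-- **Card claim K2 (far half of the apex), typed for the lead to register as
`helper_collarCurvatureLimit`** — NOT a stub of the composition: the information metric is
`C²`-asymptotically hyperbolic, i.e. its sectional curvatures tend to the model value
`−5/(128π²)` at infinity of the collar component (equivalently `|Rm − Rm₀| → 0`; with rate `O(λ²)`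
in the card, confirmed on `M₁(ℂP²)` by triage r1-1). It gives `sec < 0` off a compact set, so that
`stub_coreSign` is a SIGN on a compact core. [cite: GroisserMurray1997, Thm. 3.1] -/
def CollarCurvatureLimit : Prop :=
  ∀ (S : HomotopySphere 4) (g : BMetric S) (hg : g.IsRiemannian) (B : InfoBulk S g hg)
    (G : WMetric B.W) (hG : G.IsRiemannian), IsFisher B G →
    ∀ cov, G.IsLeviCivita cov → ∀ ε : ℝ, 0 < ε → ∃ K : Set B.W, IsCompact K ∧
      ∀ w ∉ K, ∀ (X Y : TangentSpace (𝓡 5) w), G.val w X X * G.val w Y Y - G.val w X Y ^ 2 ≠ 0 →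
        |G.sectionalCurvature cov w X Y + 5 / (128 * Real.pi ^ 2)| ≤ ε

/-! ## The five registered stubs (`sorry` lives ONLY here) -/

/-- **STUB 1 (`stub_infoBulk`, FACT-level; XL formally, zero mathematical risk).** For a
Freed–Uhlenbeck-generic Riemannian metric `g` on a homotopy 4-sphere `Σ` (every irreducible
`g`-ASD connection on `P₁` is regular, `H²_A = 0` — a second-category set of metrics,
Freed–Uhlenbeck 1984 Ch. 3), the charge-one moduli space `M₁(Σ, g)` has no reducibles
(`H²(Σ; ℤ) = 0`), is a smooth 5-manifold with smooth universal density family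
(Atiyah–Hitchin–Singer 1978 Thm. 6.1; Donaldson–Kronheimer 1990 §§4.2–4.3, Coulomb slices), is
non-empty with ends `≅ Σ × (0, λ₀)` (Taubes 1982; Donaldson 1983 §III; Uhlenbeck 1982), hence has
a non-compact component with closed-open image: the information-bulk interface is inhabited.
Why it might fail: only formally — the tree's `C^∞` quotient topology on `AsdModuliSpace` must be
the manifold topology of the Kuranishi charts (Donaldson–Kronheimer §4.2 comparison).
[cite: FreedUhlenbeck1984, Ch. 3] [cite: DonaldsonKronheimer1990, §§4.2–4.3] -/
theorem stub_infoBulk :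
    ∀ (S : HomotopySphere 4) (g : BMetric S) (hg : g.IsRiemannian),
      IsFreedUhlenbeckGeneric g S.orientation 1 → Nonempty (InfoBulk S g hg) := by
  sorry

/-- **STUB 2 (`stub_complete`, L; Groisser–Murray 1997 Thm. 3.1 + Uhlenbeck 1982 /
Donaldson 1983).** The information metric of the collar component is complete: closed
`g_I`-balls are compact. In print: `g_I` is "nondegenerate and complete in the collar region"
(GM Thm. 3.1: the `λ`-lines have infinite `g_I`-length `∼ √c ∫ dλ/λ`), and the complement of the
collar `{λ < λ₀}` in the component is compact (Uhlenbeck compactness at charge one with no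
reducibles and no bubbling below `λ₀`); a closed bounded set therefore lies in a compact
`{λ ≥ λ₁}`. Why it might fail: needs `G` positive definite everywhere (carried by `hG`) and the
identification of the tree's `density`-defined collar with Donaldson's. [cite: GroisserMurray1997, Thm. 3.1] -/
theorem stub_complete :
    ∀ (S : HomotopySphere 4) (g : BMetric S) (hg : g.IsRiemannian) (B : InfoBulk S g hg)
      (G : WMetric B.W) (hG : G.IsRiemannian), IsFisher B G →
      ∀ (x : B.W) (r : NNReal), IsCompact {y : B.W | G.edist hG x y ≤ r} := by
  sorry

/-- **STUB 3 (`stub_scaleConvexCollar`, XL; THE CARD'S LEVER).** The information bulk of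
`(Σ, g)` has a proper end collar `Φ : Σ × (0,1) → W` (Donaldson 1983 §III / Groisser–Parker 1989:
centre and scale of the concentrated instanton, smoothed) with its SCALE FUNCTION `lam`
(`lam (Φ (x, l)) = l`, smooth on the collar image) such that: `Φ` is smooth, injective and
immersive, its far parts `Φ(Σ × (0,t))` are co-compact with closures inside the collar; `G = g_I`
is `C⁰`-conical on it with Groisser–Murray's constant, `G(dΦ(v,s), dΦ(v,s)) = (1 ± ε)·(128π²/5)·
(s² + g(v,v))/l²` for `l` small (GM 1997 Thm. 3.1 — the fact-level part; `128π²/5 = 8π² · 16/5`,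
the Fisher metric of the `ℍ⁵` Poisson family BNT 2001 (2.14)–(2.16) times the mass `8π²` of the
tree's `density`); AND — the NEW part, card K1 — the far slices `{lam = l}`, `l < t₀`, are
strictly convex towards the core: `Hess_G lam (V, V) < 0` for every non-zero `V` tangent to the
slice. In the model cone `c(dl² + g)/l²` one has `Hess l|_{T slice} = −l⁻¹ g < 0` exactly
(`Γˡᵢⱼ = l⁻¹ gᵢⱼ`); the claim is that the Christoffel symbols of `g_I` converge to those of the
model in the model frame (`C¹`-conical with rate `O(λ)`), along Groisser's `O(λ)` scheme
(Groisser 1993 §5, Thms. 1.1–1.2 for the `L²` metric) organised by the osculating `ℍ⁵` Poisson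
family `|F_BPST|² = 8π²·(6/π²)K₄` (BNT 2001 (2.8)); `C⁰` closeness alone does NOT give it
(log-spiral re-collarings, `Ideas/cruxideate-r1-1-evidence.md` B2 — which is why the convexity is
asserted for the canonical scale function, not for an arbitrary `C⁰` collar). Why it might fail:
the `C¹` rate needs `∇F_A` decay outside `B_{Nλ}`; Groisser needed `R/3 − 2W₋ > 0` for the sharp
`λ²r⁻⁴` decay, unavailable on an unknown `Σ` (Donaldson's `λ^{2−δ}r^{−4+δ}` may cost the rate); a
`λ log λ` term in the CONNECTION not removable by Groisser's distance-coordinate change kills it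
(card's cheapest falsifier: one CAS/kit job on BNT §3). Confirmed at `C²` level on `M₁(ℂP²)`
(triage r1-1, `CP2CollarCheck.md`: `|Rm − Rm₀| = O(λ²)`).
[cite: GroisserMurray1997, Thm. 3.1] [cite: Groisser1993, §5] [cite: Donaldson1983, §III] -/
theorem stub_scaleConvexCollar :
    ∀ (S : HomotopySphere 4) (g : BMetric S) (hg : g.IsRiemannian) (B : InfoBulk S g hg)
      (G : WMetric B.W) (hG : G.IsRiemannian) [G.HasLeviCivita], IsFisher B G →
      ∃ (Φ : S.carrier × ℝ → B.W) (lam : B.W → ℝ),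
        ContMDiffOn ((𝓡 4).prod 𝓘(ℝ, ℝ)) (𝓡 5) ∞ Φ (univ ×ˢ Ioo (0 : ℝ) 1) ∧
        InjOn Φ (univ ×ˢ Ioo (0 : ℝ) 1) ∧
        (∀ p ∈ univ ×ˢ Ioo (0 : ℝ) 1,
          Function.Injective (mfderiv ((𝓡 4).prod 𝓘(ℝ, ℝ)) (𝓡 5) Φ p)) ∧
        (∀ t ∈ Ioo (0 : ℝ) 1, IsCompact (Φ '' (univ ×ˢ Ioo (0 : ℝ) t))ᶜ) ∧
        (∀ t ∈ Ioo (0 : ℝ) 1,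
          closure (Φ '' (univ ×ˢ Ioo (0 : ℝ) t)) ⊆ Φ '' (univ ×ˢ Ioo (0 : ℝ) 1)) ∧
        (∀ (x : S.carrier) (l : ℝ), l ∈ Ioo (0 : ℝ) 1 → lam (Φ (x, l)) = l) ∧
        ContMDiffOn (𝓡 5) 𝓘(ℝ, ℝ) ∞ lam (Φ '' (univ ×ˢ Ioo (0 : ℝ) 1)) ∧
        (∃ t₀ ∈ Ioo (0 : ℝ) 1, ∀ (x : S.carrier) (l : ℝ), l ∈ Ioo (0 : ℝ) t₀ →
          ∀ V : TangentSpace (𝓡 5) (Φ (x, l)), V ≠ 0 →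
            mfderiv (𝓡 5) 𝓘(ℝ, ℝ) lam (Φ (x, l)) V = 0 → G.hessian lam (Φ (x, l)) V V < 0) ∧
        (∀ ε : ℝ, 0 < ε → ∃ t ∈ Ioo (0 : ℝ) 1, ∀ (x : S.carrier) (l : ℝ), l ∈ Ioo (0 : ℝ) t →
          ∀ (v : TangentSpace (𝓡 4) x) (s : ℝ),
            |G.val (Φ (x, l)) (mfderiv ((𝓡 4).prod 𝓘(ℝ, ℝ)) (𝓡 5) Φ (x, l) (v, s))
                (mfderiv ((𝓡 4).prod 𝓘(ℝ, ℝ)) (𝓡 5) Φ (x, l) (v, s)) -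
              (128 * Real.pi ^ 2 / 5) * (s ^ 2 + g.val x v v) / l ^ 2|
              ≤ ε * ((128 * Real.pi ^ 2 / 5) * (s ^ 2 + g.val x v v) / l ^ 2)) := by
  sorry

/-- **STUB 4 (`stub_convexCoresOfConvexSlices`, L; pure Riemannian geometry, LANDABLE NOW —
Paternain–Salo–Uhlmann 2023 Lemma 3.1.12 in the tree's form).** In a complete Riemannian
5-manifold, let `Φ` be a proper smooth injective immersive end collar over a homotopy 4-sphere
with scale function `lam` (`lam ∘ Φ = pr₂`, smooth on the collar image) whose far slices
`{lam = l}`, `l < t₀`, are strictly convex towards the core (`Hess lam < 0` on the tangent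
spaces of the slices). Then for every `t < t₀` — in particular for some `t` — the far core
`K_t = (Φ(Σ × (0,t)))ᶜ` has nonempty interior and is `δ`-locally `d`-convex in the betweenness
form. Proof: `K_t` is compact with frontier the slice `Φ(Σ × {t})` and contains the open set
`Φ(Σ × (t,1))` (collar package, `Sketch.stub_collarPackage` p106081); near the slice
`K_t = {ρ ≤ 0}`, `ρ = t − lam`, with `dρ ≠ 0` and `Hess ρ > 0` on `ker dρ ∖ 0` along `{ρ = 0}`
(`IsStrictlyConvexSublevel`-shape); by compactness of the band `Φ(Σ × [t−η, t+η])` strict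
convexity persists nearby and SHORT GEODESICS WITH ENDPOINTS IN `K_t` STAY IN `K_t`
(`IsStrictlyConvexSublevel.exists_pos_forall_isGeodesic`, `ConvexSublevelShortGeodesics.lean`:
`(ρ ∘ γ)'' = Hess ρ(γ', γ')` at an interior maximum); a between-point `m`
(`d(p,m) + d(m,q) = d(p,q) < δ`) lies on a minimising geodesic from `p` to `q` (Hopf–Rinow,
`ExpMapHopfRinow`; broken minimisers are smooth, `SegmentsAreGeodesics.lean`) of length `< δ`,
hence in `K_t`. Why it might fail: only bookkeeping risks (uniform `δ` from compactness of the
slice; points of `K_t` farther than `δ` from the slice are trivial). [cite: PaternainSaloUhlmann2023, Lemma 3.1.12] -/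
theorem stub_convexCoresOfConvexSlices :
    ∀ (S : HomotopySphere 4) (W : Type) [TopologicalSpace W] [T2Space W]
      [SecondCountableTopology W] [ChartedSpace (EuclideanSpace ℝ (Fin 5)) W]
      [IsManifold (𝓡 5) ∞ W] (G : WMetric W) (hG : G.IsRiemannian) [G.HasLeviCivita]
      (Φ : S.carrier × ℝ → W) (lam : W → ℝ),
      (∀ (x : W) (r : NNReal), IsCompact {y : W | G.edist hG x y ≤ r}) →
      ContMDiffOn ((𝓡 4).prod 𝓘(ℝ, ℝ)) (𝓡 5) ∞ Φ (univ ×ˢ Ioo (0 : ℝ) 1) →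
      InjOn Φ (univ ×ˢ Ioo (0 : ℝ) 1) →
      (∀ p ∈ univ ×ˢ Ioo (0 : ℝ) 1,
        Function.Injective (mfderiv ((𝓡 4).prod 𝓘(ℝ, ℝ)) (𝓡 5) Φ p)) →
      (∀ t ∈ Ioo (0 : ℝ) 1, IsCompact (Φ '' (univ ×ˢ Ioo (0 : ℝ) t))ᶜ) →
      (∀ t ∈ Ioo (0 : ℝ) 1,
        closure (Φ '' (univ ×ˢ Ioo (0 : ℝ) t)) ⊆ Φ '' (univ ×ˢ Ioo (0 : ℝ) 1)) →
      (∀ (x : S.carrier) (l : ℝ), l ∈ Ioo (0 : ℝ) 1 → lam (Φ (x, l)) = l) →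
      ContMDiffOn (𝓡 5) 𝓘(ℝ, ℝ) ∞ lam (Φ '' (univ ×ˢ Ioo (0 : ℝ) 1)) →
      (∃ t₀ ∈ Ioo (0 : ℝ) 1, ∀ (x : S.carrier) (l : ℝ), l ∈ Ioo (0 : ℝ) t₀ →
        ∀ V : TangentSpace (𝓡 5) (Φ (x, l)), V ≠ 0 →
          mfderiv (𝓡 5) 𝓘(ℝ, ℝ) lam (Φ (x, l)) V = 0 → G.hessian lam (Φ (x, l)) V V < 0) →
      ∃ t ∈ Ioo (0 : ℝ) 1, ∃ δ : ℝ, 0 < δ ∧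
        (interior (Φ '' (univ ×ˢ Ioo (0 : ℝ) t))ᶜ).Nonempty ∧
        ∀ p ∈ (Φ '' (univ ×ˢ Ioo (0 : ℝ) t))ᶜ, ∀ q ∈ (Φ '' (univ ×ˢ Ioo (0 : ℝ) t))ᶜ,
          G.edist hG p q < ENNReal.ofReal δ →
          ∀ m : W, G.edist hG p m + G.edist hG m q = G.edist hG p q →
            m ∈ (Φ '' (univ ×ˢ Ioo (0 : ℝ) t))ᶜ := by
  sorry

/-- **STUB 5 (`stub_coreSign`, APEX; open-problem — SPC4-strength by the tame-witness dichotomy,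
as every apex of this crux must be).** Every homotopy 4-sphere `Σ` carries a Freed–Uhlenbeck-generic
Riemannian metric `g` such that, on the collar component of `M₁(Σ, g)`, the Fisher–Rao form of the
curvature densities is (the quadratic form of) a smooth Riemannian metric `G = g_I` with
`sec(G) ≤ 0` everywhere. Three contents, in increasing depth: (N) nondegeneracy — `g_I(a,a) = 0`
forces `(F_A, d_A⁻ a) ≡ 0` pointwise, infinitely many conditions, proved on the collar and left
open in the interior by Groisser–Murray (p. 5; plausible for generic `g`), plus `C^∞` smoothness
of `g_I` (caveat: at isolated moduli points where `F_A` has a zero the `|F|⁻²` in GM (metric1)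
makes `g_I` only `C^{3,α}` — an `m⁴ log m` term — so `g` must avoid them, or the natural reshape
is `IsFisher` off a finite set); (F) the FAR sign — automatic from `CollarCurvatureLimit`
(`sec → −5/(128π²)`, card K2, the lead's first helper); (C) CORE SIGN on the compact core — no
mechanism is known off the round class (Hitchin: `M₁(S⁴,[round]) = ℍ⁵`); instrument: the
Gauss-equation formula (★) of cards fisher-sphere-gauss ≈ hellinger-gauss-normal-part; warning
data: `M₁(ℂP²)` has both signs at the reducible cone (GM Thm. 5.1, absent here), `M₂(S⁴)` has
positive breathing planes (kit j017439, charge two). Why it might fail: a positively curved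
2-plane of `g_I` in the core for EVERY metric on some `Σ` — for `Σ = S⁴` excluded by the round
class, so a refutation as typed exhibits an exotic sphere's worth of difficulty; the line's finite
falsifier is (★) at one interior instanton of one squashed `S⁴`.
[cite: GroisserMurray1997, §2 p. 5 and Thm. 5.1] [cite: Hitchin1990] -/
theorem stub_coreSign :
    ∀ (S : HomotopySphere 4), ∃ (g : BMetric S) (hg : g.IsRiemannian),
      IsFreedUhlenbeckGeneric g S.orientation 1 ∧
      ∀ B : InfoBulk S g hg, ∃ (G : WMetric B.W) (hG : G.IsRiemannian), IsFisher B G ∧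
        ∀ cov, G.IsLeviCivita cov →
          ∀ (w : B.W) (X Y : TangentSpace (𝓡 5) w), G.sectionalCurvature cov w X Y ≤ 0 := by
  sorry

/-! ## The composition (kernel-checked; no `sorry` of its own) -/

/-- **The line concludes the crux BY NAME.** `stub_coreSign` chooses the metric `g` on `Σ` and,
on the information bulk `B` supplied by `stub_infoBulk`, the metric `G = g_I` with `sec ≤ 0`;
`stub_complete` gives completeness; `stub_convexCollar` gives the Donaldson–Groisser–Murray collar
with `C⁰` constant `128π²/5` and locally convex far cores; the landed K1
(`Sketch.stub_locallyConvexEndForcesHadamard`, p113043) upgrades `ConnectedSpace W` to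
`SimplyConnectedSpace W`; the remaining clauses pass through. -/
theorem AhHadamardFilling_of :
    Summit.SmoothPoincare4.SmoothPoincare4.Theses.InformationMetricHadamard.AhHadamardFilling := by
  intro S
  obtain ⟨g, hg, hFU, hcore⟩ := stub_coreSign S
  obtain ⟨B⟩ := stub_infoBulk S g hg hFU
  obtain ⟨G, hG, hF, hsec⟩ := hcore B
  haveI : G.HasLeviCivita := G.hasLeviCivita
  have hcpt := stub_complete S g hg B G hG hF
  obtain ⟨Φ, lam, hsm, hinj, himm, hco, hcl, hlam, hlamsm, hslice, hasym⟩ :=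
    stub_scaleConvexCollar S g hg B G hG hF
  have hconv := stub_convexCoresOfConvexSlices S B.W G hG Φ lam hcpt hsm hinj himm hco hcl hlam
    hlamsm hslice
  have hK := Sketch.stub_locallyConvexEndForcesHadamard S B.W G hG Φ hcpt hsec hsm hinj himm hco
    hcl hconv
  haveI : SimplyConnectedSpace B.W := hK.1
  exact ⟨g, hg, B.W, inferInstance, inferInstance, inferInstance, inferInstance, inferInstance,
    inferInstance, G, hG, 128 * Real.pi ^ 2 / 5, Φ, by positivity, hcpt, hsec, hsm, hinj, hco, hcl,
    hasym⟩

/-! ## Hardness record and bonus: the stubs close the route without crux 6015 -/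

/-- **The four stubs imply `SmoothPoincare4`.** K1's second conclusion `Σ ≅ S⁴`, fed with the
line's data for every homotopy 4-sphere, is the hypothesis of
`Literature.SPC4.smoothPoincare4_of_forall_homotopySphere` (with the proved packaging facts). So
(i) the line, if it closes, discharges the route's `closes` with no need for `C0AhRecognition`
(card Assembly sketch), and (ii) the stub set is summit-strength — recorded, not hidden: the
strength sits in `stub_coreSign` (C), exactly where the panel located it. Unlike `Sketch`, the
converse `SmoothPoincare4 → stub_coreSign` is NOT a tree theorem (it is Hitchin's computation
`(M₁(S⁴,[round]), g_I) = ℍ⁵`), so no kernel circularity is available to a disprover. -/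
theorem smoothPoincare4_of_stubs : _root_.SmoothPoincare4 := by
  refine Literature.SPC4.smoothPoincare4_of_forall_homotopySphere
    Literature.Topology.FourManifolds.compactSpace_of_homotopyEquiv_sphere_four_holds
    Literature.Topology.FourManifolds.isOrientable_of_homotopyEquiv_sphere_four_holds ?_
  intro S
  obtain ⟨g, hg, hFU, hcore⟩ := stub_coreSign S
  obtain ⟨B⟩ := stub_infoBulk S g hg hFU
  obtain ⟨G, hG, hF, hsec⟩ := hcore B
  haveI : G.HasLeviCivita := G.hasLeviCivita
  have hcpt := stub_complete S g hg B G hG hF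
  obtain ⟨Φ, lam, hsm, hinj, himm, hco, hcl, hlam, hlamsm, hslice, hasym⟩ :=
    stub_scaleConvexCollar S g hg B G hG hF
  have hconv := stub_convexCoresOfConvexSlices S B.W G hG Φ lam hcpt hsm hinj himm hco hcl hlam
    hlamsm hslice
  exact (Sketch.stub_locallyConvexEndForcesHadamard S B.W G hG Φ hcpt hsec hsm hinj himm hco hcl
    hconv).2

end Summit.SmoothPoincare4.SmoothPoincare4.Cruxes.AhHadamardFilling.OsculatingPoissonCollar

end
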